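import Summits.PneNP.PneNP.Theorems.SoloInformedIOShape
import Literature.Computability.MetaComplexity.McKayMurrayWilliams2019.UniformStreamingConstructible
import HarnessLib

/-!
# Solo (informed) — the width of the magnification door for every time-constructible `s`

Summit-side corollaries of the Literature discharge
`Literature/Computability/MetaComplexity/McKayMurrayWilliams2019/UniformStreamingConstructible.lean`
(`thm13_holds`: McKay–Murray–Williams 2019, Thm. 1.3, for every time-constructible size function):

* `soloInformed_mcspSize_mem_USTREAM_of_not_pneNP_tc` — the width of the door: if `¬ PneNP` then
  for every time-constructible `s`, `MCSP[s]` IS decided by a uniform streaming algorithm with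
  space and update time `s(log₂ N)^c + c` for some `c`;
* `soloInformed_pneNP_or_mcsp_uniformly_streamable` — the same as a dichotomy: `PneNP`, or every
  `MCSP[s]` with time-constructible `s` is uniformly streamable in `poly(s(log₂ N))`.

(The forward door `StreamingLowerBound s → PneNP` for time-constructible `s` is already in the
tree — for polynomially honest `s` as `soloInformed_pneNP_of_streamingLowerBound[_pow]`,
`SoloInformedStreaming.lean`, and in full generality as a theorem of another seat which the gate's
dedup names; it is not restated here.)

What a proof through this door must do (solo programme, `paper/sharpest-statement.md` §3(b)):
exhibit ONE time-constructible `s` and show, for EVERY `c`, that no single `TM2` update machine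
fed `⟨bin N, state, bit⟩`, keeping states of `≤ s(log₂ N)^c + c` bits and running
`≤ s(log₂ N)^c + c` steps per bit (with a report machine of the same budget), decides `MCSP[s]`.
The width lemma shows the state may be taken to be a LOSSLESS summary of the prefix (a small
consistent straight-line program), so no information-theoretic argument can supply the bound —
only a lower bound on the update TIME (McKay–Murray–Williams 2019, §1.1 after Thm. 1.3: "there is
no information-theoretic barrier to such a streaming algorithm, only a computational one").
By Lupanov's bound every `n`-ary function has circuits of size `(1+o(1))·2ⁿ/n`, which is why no
instance is recorded for the (time-constructible) exponential bounds `2^{kn}`, `k ≥ 1`: there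
`MCSP[2^{kn}]` is eventually trivial.
-/

namespace Summit.PneNP.PneNP.Theorems

open Literature.Computability.Complexity Literature.Computability.MetaComplexity
open Literature.Computability.MetaComplexity.McKayMurrayWilliams2019

/-- **Width of the door (every time-constructible `s`).** If `¬ PneNP` (i.e. `P = NP`) then
`MCSP[s]` is decided by a uniform one-pass streaming algorithm with space and update/report time
`s(log₂ N)^c + c` for some `c`. [cite: McKayMurrayWilliams2019, Thm. 1.2] -/
theorem soloInformed_mcspSize_mem_USTREAM_of_not_pneNP_tc (hP : ¬ PneNP) {s : ℕ → ℕ}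
    (hs : IsTimeConstructible s) :
    ∃ c : ℕ, MCSPSize s ∈
      USTREAM (fun N => s (Nat.log 2 N) ^ c + c) (fun N => s (Nat.log 2 N) ^ c + c) := by
  refine MCSPSize_mem_USTREAM_of_NP_subset_P_of_isTimeConstructible (fun L hL => ?_) hs
  by_contra hLP
  exact hP (soloInformed_pneNP_iff_exists_not_mem.2 ⟨L, hL, hLP⟩)

/-- **Dichotomy form.** Either `PneNP`, or every `MCSP[s]` with time-constructible `s` is
uniformly streamable in `poly(s(log₂ N))` space and update time.
[cite: McKayMurrayWilliams2019, Thm. 1.2, Thm. 1.3] -/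
theorem soloInformed_pneNP_or_mcsp_uniformly_streamable :
    PneNP ∨ ∀ s : ℕ → ℕ, IsTimeConstructible s → ∃ c : ℕ, MCSPSize s ∈
      USTREAM (fun N => s (Nat.log 2 N) ^ c + c) (fun N => s (Nat.log 2 N) ^ c + c) :=
  (em PneNP).imp_right fun hP _ hs => soloInformed_mcspSize_mem_USTREAM_of_not_pneNP_tc hP hs

end Summit.PneNP.PneNP.Theorems
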